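import Mathlib
import HarnessLib

/-!
# Route `F4SubCurvatureDoor`, crux `SubCurvatureKernel` ⟨stmt-QuantumFields-23036⟩ — `L¹` EXTENSION of a functional bounded on smooth
# compactly supported test functions

Helper file (`--supports stmt-QuantumFields-23036 --as helper`; free-hands seat `ym-line-frs-p2` g17, piece (K2′) of the kernel-extraction
clause (K) of the soft-half scope, HOME INBOX 2026-08-29T16:34:27Z / 16:47:40Z).  Definition-free, GENERIC functional analysis (no lattice
input), Mathlib only, 0 sorry, standard axioms.  No item is closed; no summit, no crux and no mass gap is proved by this file.

WHAT.  The density clause of an off-diagonal limit point (`OffDiagDensity`: `‖S₁ n F‖ ≤ B ∫ ‖F‖` for compactly supported test functions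
supported at pairwise distance `≥ δ`) bounds the functional by the `L¹` norm ON SMOOTH COMPACTLY SUPPORTED FUNCTIONS only.  To feed the
LEAD's (K-core) «an `L¹`-bounded continuous linear functional has an essentially bounded density» one needs the functional ON `L¹`:

* `exists_extend_L1` — a real-valued functional `ℓ` on functions `X → ℝ` (finite-dimensional `X`, measure `μ` finite on compacts and
  positive on opens), additive and homogeneous on smooth compactly supported functions and bounded there by `B ∫ |f| dμ`, is induced by a
  (unique) continuous linear functional `W` on `L¹(μ)` with `|W F| ≤ B ‖F‖`: `W F = ℓ f` whenever `F =ᵐ f` with `f` smooth of compact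
  support.  Proof: smooth compactly supported classes form a DENSE subspace of `L¹` (Mathlib `Lp.dense_hasCompactSupport_contDiff`);
  `ℓ` is well defined on it (two continuous representatives of one class coincide, `Continuous.ae_eq_iff_eq`) and bounded, hence extends
  (`ContinuousLinearMap.extend`, `opNorm_extend_le`).

References: folklore (BLT / bounded linear extension theorem; e.g. Reed–Simon I, Thm I.7).

HONEST LABEL: one functional-analytic piece of clause (K) of the SOFT half of ⟨23036⟩; (K) proper also needs (K-core), fibre averaging
(✓ sibling file) and gluing, (C) continuity and — above all — the SUB-CURVATURE clause remain OPEN; ⟨23036⟩ is an open problem; the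
Yang–Mills mass gap is NOT proved; no summit is proved by a line.
-/

set_option autoImplicit false

noncomputable section

open scoped BigOperators ContDiff ENNReal
open MeasureTheory Filter Topology Set

namespace Summit.QuantumFields.YangMills.Theorems.F4SubCurvatureDoorSubCurvatureKernelL1

variable {X : Type*} [NormedAddCommGroup X] [NormedSpace ℝ X] [FiniteDimensional ℝ X] [MeasurableSpace X] [BorelSpace X]

omit [NormedSpace ℝ X] [FiniteDimensional ℝ X] [BorelSpace X] in
/-- Two continuous functions that agree almost everywhere for a measure positive on open sets agree everywhere. [folklore] -/
theorem eq_of_ae_eq_of_continuous {μ : Measure X} [μ.IsOpenPosMeasure] {f g : X → ℝ} (hf : Continuous f) (hg : Continuous g)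
    (h : f =ᵐ[μ] g) : f = g :=
  (Continuous.ae_eq_iff_eq μ hf hg).1 h

/-- ★ **`L¹` EXTENSION (BLT).**  A functional on functions `X → ℝ`, additive and homogeneous on smooth compactly supported functions and
bounded there by `B · ∫ |f| dμ`, is induced on that class by a continuous linear functional `W` on `L¹(μ)` with `|W F| ≤ B ‖F‖`.
[folklore] -/
theorem exists_extend_L1 (μ : Measure X) [IsFiniteMeasureOnCompacts μ] [μ.IsOpenPosMeasure] (ℓ : (X → ℝ) → ℝ)
    (hadd : ∀ f g : X → ℝ, HasCompactSupport f → ContDiff ℝ ∞ f → HasCompactSupport g → ContDiff ℝ ∞ g →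
      ℓ (f + g) = ℓ f + ℓ g)
    (hsmul : ∀ (c : ℝ) (f : X → ℝ), HasCompactSupport f → ContDiff ℝ ∞ f → ℓ (c • f) = c * ℓ f)
    {B : ℝ} (hB : 0 ≤ B)
    (hbound : ∀ f : X → ℝ, HasCompactSupport f → ContDiff ℝ ∞ f → |ℓ f| ≤ B * ∫ x, |f x| ∂μ) :
    ∃ W : (X →₁[μ] ℝ) →L[ℝ] ℝ, (∀ F : X →₁[μ] ℝ, |W F| ≤ B * ‖F‖) ∧
      ∀ (f : X → ℝ), HasCompactSupport f → ContDiff ℝ ∞ f → ∀ F : X →₁[μ] ℝ, (F : X → ℝ) =ᵐ[μ] f → W F = ℓ f := by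
  classical
  -- the dense subspace of smooth compactly supported classes
  let S : Submodule ℝ (X →₁[μ] ℝ) :=
    { carrier := {F | ∃ g : X → ℝ, (F : X → ℝ) =ᵐ[μ] g ∧ HasCompactSupport g ∧ ContDiff ℝ ∞ g}
      add_mem' := by
        rintro F G ⟨f, hFf, hfc, hfs⟩ ⟨g, hGg, hgc, hgs⟩
        exact ⟨f + g, (Lp.coeFn_add F G).trans (hFf.add hGg), hfc.add hgc, hfs.add hgs⟩
      zero_mem' := ⟨0, Lp.coeFn_zero ℝ 1 μ, HasCompactSupport.zero, contDiff_const⟩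
      smul_mem' := by
        rintro c F ⟨f, hFf, hfc, hfs⟩
        refine ⟨c • f, (Lp.coeFn_smul c F).trans (hFf.mono fun x hx => by simp [hx]), ?_, contDiff_const.smul hfs⟩
        exact hfc.smul_left (f := fun _ : X => c) }
  have hSdense : Dense (S : Set (X →₁[μ] ℝ)) :=
    MeasureTheory.Lp.dense_hasCompactSupport_contDiff (μ := μ) (F := ℝ) (p := 1) ENNReal.one_ne_top
  -- a smooth compactly supported representative of each class in `S`, unique
  have hrep : ∀ F : S, ∃ g : X → ℝ, ((F : X →₁[μ] ℝ) : X → ℝ) =ᵐ[μ] g ∧ HasCompactSupport g ∧ ContDiff ℝ ∞ g :=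
    fun F => F.2
  choose rep hrep_ae hrep_c hrep_s using hrep
  have huniq : ∀ (F : S) (g : X → ℝ), ((F : X →₁[μ] ℝ) : X → ℝ) =ᵐ[μ] g → HasCompactSupport g → ContDiff ℝ ∞ g →
      rep F = g := fun F g hg _ hgs =>
    eq_of_ae_eq_of_continuous (hrep_s F).continuous hgs.continuous ((hrep_ae F).symm.trans hg)
  -- `ℓ` on `S`: linear …
  let ℓS : S →ₗ[ℝ] ℝ :=
    { toFun := fun F => ℓ (rep F)
      map_add' := fun F G => by
        have h : rep (F + G) = rep F + rep G :=
          huniq (F + G) _ ((Lp.coeFn_add (F : X →₁[μ] ℝ) G).trans ((hrep_ae F).add (hrep_ae G)))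
            ((hrep_c F).add (hrep_c G)) ((hrep_s F).add (hrep_s G))
        simp only [h]
        exact hadd _ _ (hrep_c F) (hrep_s F) (hrep_c G) (hrep_s G)
      map_smul' := fun c F => by
        have h : rep (c • F) = c • rep F :=
          huniq (c • F) _ ((Lp.coeFn_smul c (F : X →₁[μ] ℝ)).trans ((hrep_ae F).mono fun x hx => by simp [hx]))
            ((hrep_c F).smul_left (f := fun _ : X => c)) (contDiff_const.smul (hrep_s F))
        simp only [h, RingHom.id_apply, smul_eq_mul]
        exact hsmul c _ (hrep_c F) (hrep_s F) }
  -- … and bounded by `B ‖F‖`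
  have hℓS : ∀ F : S, ‖ℓS F‖ ≤ B * ‖F‖ := by
    intro F
    have hnorm : ‖F‖ = ∫ x, |rep F x| ∂μ := by
      rw [Submodule.coe_norm, L1.norm_eq_integral_norm]
      exact integral_congr_ae ((hrep_ae F).mono fun x hx => by beta_reduce; rw [hx, Real.norm_eq_abs])
    rw [Real.norm_eq_abs, hnorm]
    exact hbound _ (hrep_c F) (hrep_s F)
  let ℓS' : S →L[ℝ] ℝ := ℓS.mkContinuous B hℓS
  have hℓS'norm : ‖ℓS'‖ ≤ B := ℓS.mkContinuous_norm_le hB hℓS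
  -- extension to `L¹`
  have hdense : DenseRange S.subtypeL := by
    rw [show (S.subtypeL : S → (X →₁[μ] ℝ)) = ((↑) : S → (X →₁[μ] ℝ)) from rfl, denseRange_subtype_val]
    exact hSdense
  have hui : IsUniformInducing S.subtypeL := isUniformEmbedding_subtype_val.isUniformInducing
  let W : (X →₁[μ] ℝ) →L[ℝ] ℝ := ℓS'.extend S.subtypeL
  have hWnorm : ‖W‖ ≤ B := by
    have h := ℓS'.opNorm_extend_le (e := S.subtypeL) hdense (N := 1) (fun F => by simp)
    exact h.trans (by rw [NNReal.coe_one, one_mul]; exact hℓS'norm)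
  refine ⟨W, fun F => ?_, fun f hfc hfs F hF => ?_⟩
  · rw [← Real.norm_eq_abs]
    exact (W.le_opNorm F).trans (mul_le_mul_of_nonneg_right hWnorm (norm_nonneg _))
  · have hFS : F ∈ S := ⟨f, hF, hfc, hfs⟩
    have hW : W (S.subtypeL ⟨F, hFS⟩) = ℓS' ⟨F, hFS⟩ := ℓS'.extend_eq hdense hui ⟨F, hFS⟩
    have hW' : W F = ℓS' ⟨F, hFS⟩ := by simpa only [Submodule.subtypeL_apply] using hW
    rw [hW']
    show ℓ (rep ⟨F, hFS⟩) = ℓ f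
    rw [huniq ⟨F, hFS⟩ f hF hfc hfs]

end Summit.QuantumFields.YangMills.Theorems.F4SubCurvatureDoorSubCurvatureKernelL1

end
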